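import Summits.Ventures.PercRepro.GenQBalance
import Summits.Ventures.PercRepro.PlaneCore

/-!
# PercRepro — C-025 at `(q + 2, q)`: the coloop split `ρ(B ∖ coloops) + m(B) = ρ(B)`, Lemma 21.1 at every `q`, and
the type-`1` balance for every `q` by the counting of §21.2 (night-4, gen 0)

Three more structural facts about the general balance `Jq M G q t` of `GenQBalance.lean`, valid for every `q` by the
same counting as at `(6, 4)`:

* `eRk_sdiff_add_card_of_subset_coloops` / `eRk_sdiff_coloops_add_mTr`: removing coloops of `M|B` lowers the rank by
  exactly their number — `M|B = (M|(B ∖ C)) ⊕ (free coloops)` in rank form;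
* **`mTr_add_two_le_of_simple`** — LEMMA 21.1 AT EVERY `q`: in a simple matroid a rank-`q` set with `≥ q + 1` points has at
  most `q − 2` coloops (the landed `mTr_le_two_of_five_le` is the case `q = 4`), so `w_∞(B) ≥ 1/(q − 1)` off the
  independent `q`-sets (`wInf_ge_of_succ_le_card`);
* `card_Iq_mul_le` — the double count of §21.2: every independent `q`-subset of `G` lies in `g − q` rank-`q` sets with
  `q + 1` points and every such set contains at most `q + 1` of them: `I_q · (g − q) ≤ (q + 1) · N_{q+1}`;
* **`Jq_one_nonneg`** — THE TYPE-`1` BALANCE AT EVERY `q` (mine-2's 21.2 in general): for a simple matroid, a rank-`q`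
  set `G` with `g` points and `q ≥ 2`, `0 ≤ Jq M G q 1` as soon as `(g − q)(q + 3) ≥ q² − 1` (at `q = 4`: `g ≥ 7`, as
  in 21.2; the deficit `1/(q + 1)` of each independent `q`-set against the surplus `(q + 3)/((q − 1)(q + 1))` of each
  larger set).  The small sizes `q ≤ g < q + (q² − 1)/(q + 3)` are NOT covered (at `(6, 4)` they are the bonus
  argument of 21.2 with the catalogue numbers): they stay inside the residue `PerFlatResidue q`.
-/

namespace PercRepro.GenQ

open Finset ThmH SixFour

variable {α : Type*} [DecidableEq α] {M : Matroid α} [M.Finite]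

/-! ## The coloop split -/

/-- Removing a set of coloops of `M|B` lowers the rank by exactly its size. -/
theorem eRk_sdiff_add_card_of_subset_coloops {B : Finset α} (hB : B ⊆ gr M) :
    ∀ C : Finset α, C ⊆ coloopsOf M B →
      M.eRk ((B \ C : Finset α) : Set α) + C.card = M.eRk (B : Set α) := by
  intro C
  induction C using Finset.induction_on with
  | empty =>
    intro _
    simp
  | @insert c C' hc ih =>
    intro hC
    have hcC : c ∈ coloopsOf M B := hC (Finset.mem_insert_self c C')
    have hC' : C' ⊆ coloopsOf M B := (Finset.subset_insert c C').trans hC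
    have hcB : c ∈ B := (mem_coloopsOf.1 hcC).1
    have hccl : c ∉ M.closure ((B.erase c : Finset α) : Set α) := (mem_coloopsOf.1 hcC).2
    have hcE : c ∈ M.E := by
      rw [← coe_gr M]
      exact_mod_cast hB hcB
    have hsub : B \ insert c C' ⊆ B.erase c := by
      intro x hx
      rw [Finset.mem_sdiff, Finset.mem_insert] at hx
      rw [Finset.mem_erase]
      exact ⟨fun h => hx.2 (Or.inl h), hx.1⟩
    have hcl' : c ∉ M.closure ((B \ insert c C' : Finset α) : Set α) := fun h =>
      hccl (M.closure_subset_closure (Finset.coe_subset.2 hsub) h)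
    have heq : B \ C' = insert c (B \ insert c C') := by
      ext x
      rw [Finset.mem_insert, Finset.mem_sdiff, Finset.mem_sdiff, Finset.mem_insert]
      constructor
      · intro hx
        by_cases hxc : x = c
        · exact Or.inl hxc
        · exact Or.inr ⟨hx.1, fun h => h.elim hxc hx.2⟩
      · rintro (rfl | hx)
        · exact ⟨hcB, hc⟩
        · exact ⟨hx.1, fun h => hx.2 (Or.inr h)⟩
    have h1 : M.eRk ((B \ C' : Finset α) : Set α) = M.eRk ((B \ insert c C' : Finset α) : Set α) + 1 := by
      rw [heq, Finset.coe_insert]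
      exact Matroid.eRk_insert_eq_add_one ⟨hcE, hcl'⟩
    have ih' := ih hC'
    rw [Finset.card_insert_of_notMem hc, Nat.cast_succ, ← add_assoc, add_right_comm, ← h1, ih']

/-- `ρ(B ∖ coloops) + m(B) = ρ(B)`. -/
theorem eRk_sdiff_coloops_add_mTr {B : Finset α} (hB : B ⊆ gr M) :
    M.eRk ((B \ coloopsOf M B : Finset α) : Set α) + mTr M B = M.eRk (B : Set α) :=
  eRk_sdiff_add_card_of_subset_coloops hB _ (subset_refl _)

/-- **Lemma 21.1 at every `q ≥ 1`**: in a simple matroid a rank-`q` set with at least `q + 1` points has at most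
`q − 2` coloops (`q − 1` coloops would leave a rank-`≤ 1` set with two distinct points; `q = 1` is vacuous). -/
theorem mTr_add_two_le_of_simple (hs : Simple M) {B : Finset α} {q : ℕ} (hq : 1 ≤ q) (hB : B ⊆ gr M)
    (hr : M.eRk (B : Set α) = (q : ℕ∞)) (hcard : q + 1 ≤ B.card) : mTr M B + 2 ≤ q := by
  by_contra hlt
  push Not at hlt
  have hm := mTr_le_of_eRk_eq hB hr
  have hsplit := eRk_sdiff_coloops_add_mTr hB
  rw [hr] at hsplit
  obtain ⟨k, hk, -⟩ := eRk_eq_nat M (B \ coloopsOf M B)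
  rw [hk] at hsplit
  have hk' : k + mTr M B = q := by exact_mod_cast hsplit
  have hFc := Finset.card_sdiff_add_card_eq_card (coloopsOf_subset (M := M) B)
  unfold mTr at hm hlt hk'
  have hFsub : B \ coloopsOf M B ⊆ gr M := Finset.sdiff_subset.trans hB
  rcases Nat.lt_or_ge 1 (B \ coloopsOf M B).card with hF2 | hF1
  · -- two points of `F`: rank `≥ 2`, but `ρ(F) = k ≤ 1`
    obtain ⟨e, he, f, hf, hef⟩ := Finset.one_lt_card.1 hF2
    have h2 := two_le_eRk_of_two_mem hs hFsub he hf hef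
    rw [hk] at h2
    have h2' : 2 ≤ k := by exact_mod_cast h2
    omega
  · -- `|F| = 1`: then `|C| = q`, `ρ(F) = 0`, and a second point of `B` gives rank `≤ 1` to a pair
    have hF1' : 1 ≤ (B \ coloopsOf M B).card := by omega
    obtain ⟨e, he⟩ := Finset.card_pos.1 hF1'
    have hk0 : k = 0 := by omega
    obtain ⟨f, hf, hfe⟩ : ∃ f ∈ B, f ≠ e := by
      by_contra hcon
      push Not at hcon
      have hsub : B ⊆ {e} := fun x hx => by
        rw [Finset.mem_singleton]
        exact hcon x hx
      have := Finset.card_le_card hsub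
      rw [Finset.card_singleton] at this
      omega
    have hsub' : insert f (B \ coloopsOf M B) ⊆ gr M := Finset.insert_subset (hB hf) hFsub
    have h2 := two_le_eRk_of_two_mem hs hsub' (Finset.mem_insert_of_mem he) (Finset.mem_insert_self f _)
      (Ne.symm hfe)
    have h1 : M.eRk ((insert f (B \ coloopsOf M B) : Finset α) : Set α) ≤
        M.eRk ((B \ coloopsOf M B : Finset α) : Set α) + 1 := by
      rw [Finset.coe_insert]
      exact M.eRk_insert_le_add_one f _
    rw [hk, hk0] at h1
    have h3 : (2 : ℕ∞) ≤ ((0 : ℕ) : ℕ∞) + 1 := h2.trans h1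
    have h3' : (2 : ℕ) ≤ 0 + 1 := by exact_mod_cast h3
    omega

/-- Off the independent `q`-sets, `w_∞(B) ≥ 1/(q − 1)` in a simple matroid. -/
theorem wInf_ge_of_succ_le_card (hs : Simple M) {B : Finset α} {q : ℕ} (hq : 1 ≤ q) (hB : B ⊆ gr M)
    (hr : M.eRk (B : Set α) = (q : ℕ∞)) (hcard : q + 1 ≤ B.card) : 1 / ((q : ℚ) - 1) ≤ wInf M B := by
  have h := mTr_add_two_le_of_simple hs hq hB hr hcard
  have h' : (mTr M B : ℚ) + 2 ≤ q := by exact_mod_cast h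
  unfold wInf
  apply one_div_le_one_div_of_le
  · positivity
  · linarith

/-! ## The double count of §21.2 -/

/-- The independent `q`-subsets of `G` (rank `q`, `q` points). -/
noncomputable def Iq (M : Matroid α) [M.Finite] (G : Finset α) (q : ℕ) : Finset (Finset α) :=
  (Rq M G q).filter (fun B : Finset α => B.card = q)

/-- The rank-`q` subsets of `G` with exactly `q + 1` points. -/
noncomputable def Nq1 (M : Matroid α) [M.Finite] (G : Finset α) (q : ℕ) : Finset (Finset α) :=
  (Rq M G q).filter (fun B : Finset α => B.card = q + 1)

/-- **The double count**: `I_q · (g − q) ≤ (q + 1) · N_{q+1}` — `(B, y) ↦ B ∪ {y}` maps the pairs (independent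
`q`-set, point of `G` off it) onto rank-`q` sets with `q + 1` points, at most `q + 1` pairs per set. -/
theorem card_Iq_mul_le {G : Finset α} {q : ℕ} (hr : M.eRk (G : Set α) = (q : ℕ∞)) :
    (Iq M G q).card * (G.card - q) ≤ (q + 1) * (Nq1 M G q).card := by
  classical
  set s : Finset (Σ _ : Finset α, α) := (Iq M G q).sigma (fun B => G \ B) with hs
  have hcard_s : s.card = (Iq M G q).card * (G.card - q) := by
    rw [hs, Finset.card_sigma]
    rw [Finset.card_eq_sum_ones (Iq M G q), Finset.sum_mul]
    apply Finset.sum_congr rfl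
    intro B hB
    rw [Iq, Finset.mem_filter, mem_Rq] at hB
    rw [Finset.card_sdiff_of_subset hB.1.1, hB.2, one_mul]
  have hmaps : ∀ p ∈ s, insert p.2 p.1 ∈ Nq1 M G q := by
    intro p hp
    rw [hs, Finset.mem_sigma] at hp
    obtain ⟨hB, hy⟩ := hp
    rw [Iq, Finset.mem_filter, mem_Rq] at hB
    rw [Finset.mem_sdiff] at hy
    rw [Nq1, Finset.mem_filter, mem_Rq]
    have hsub : insert p.2 p.1 ⊆ G := Finset.insert_subset hy.1 hB.1.1
    refine ⟨⟨hsub, ?_⟩, ?_⟩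
    · apply le_antisymm
      · rw [← hr]
        exact M.eRk_mono (Finset.coe_subset.2 hsub)
      · rw [← hB.1.2]
        exact M.eRk_mono (Finset.coe_subset.2 (Finset.subset_insert _ _))
    · rw [Finset.card_insert_of_notMem hy.2, hB.2]
  have hfib : ∀ C ∈ Nq1 M G q, (s.filter (fun p => insert p.2 p.1 = C)).card ≤ q + 1 := by
    intro C hC
    rw [Nq1, Finset.mem_filter] at hC
    rw [← hC.2]
    apply Finset.card_le_card_of_injOn (fun p : (Σ _ : Finset α, α) => p.2)
    · intro p hp
      rw [Finset.mem_coe, Finset.mem_filter] at hp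
      rw [Finset.mem_coe, ← hp.2]
      exact Finset.mem_insert_self _ _
    · intro p hp p' hp' hpp'
      rw [Finset.mem_coe, Finset.mem_filter, hs, Finset.mem_sigma] at hp hp'
      simp only at hpp'
      have h1 : p.1 = p'.1 := by
        have e1 : p.1 = (insert p.2 p.1).erase p.2 :=
          (Finset.erase_insert (Finset.mem_sdiff.1 hp.1.2).2).symm
        have e2 : p'.1 = (insert p'.2 p'.1).erase p'.2 :=
          (Finset.erase_insert (Finset.mem_sdiff.1 hp'.1.2).2).symm
        rw [e1, e2, hp.2, hp'.2, hpp']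
      exact Sigma.ext h1 (heq_of_eq hpp')
  rw [← hcard_s]
  exact Finset.card_le_mul_card_image_of_maps_to hmaps (q + 1) hfib

/-! ## The type-`1` balance at every `q` -/

/-- `G` itself is demand-free at type `1`: `DF_1 ≥ 1`. -/
theorem one_le_DFq_one {G : Finset α} {q : ℕ} (hr : M.eRk (G : Set α) = (q : ℕ∞)) : 1 ≤ DFq M G q 1 := by
  unfold DFq
  apply Finset.card_pos.2
  refine ⟨G, ?_⟩
  rw [Finset.mem_filter, mem_Rq]
  refine ⟨⟨subset_refl G, hr⟩, ?_⟩
  rw [Finset.sdiff_self, Finset.coe_empty, M.eRk_empty]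
  simp

/-- **The type-`1` balance at every `q`** (mine-2's 21.2 in general): for a simple matroid and a rank-`q` set `G`
with `g` points, `q ≥ 2` and `(g − q)(q + 3) ≥ q² − 1`, `0 ≤ Jq M G q 1`. -/
theorem Jq_one_nonneg (hs : Simple M) {G : Finset α} {q : ℕ} (hG : G ⊆ gr M)
    (hr : M.eRk (G : Set α) = (q : ℕ∞)) (hq : 2 ≤ q) (hg : q * q ≤ (G.card - q) * (q + 3) + 1) :
    0 ≤ Jq M G q 1 := by
  classical
  -- the two kinds of rank-`q` sets
  set I := Iq M G q with hI
  set Rb := (Rq M G q).filter (fun B : Finset α => ¬ B.card = q) with hRb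
  have hN : (Nq M G q : ℚ) = (I.card : ℚ) + (Rb.card : ℚ) := by
    rw [hI, hRb, Iq]
    unfold Nq
    exact_mod_cast (Finset.card_filter_add_card_filter_not _).symm
  have hNq1 : (Nq1 M G q).card ≤ Rb.card := by
    apply Finset.card_le_card
    intro B hB
    rw [Nq1, Finset.mem_filter] at hB
    rw [hRb, Finset.mem_filter]
    exact ⟨hB.1, by omega⟩
  have hdc := card_Iq_mul_le (M := M) hr
  -- the supply
  have hq1 : (0 : ℚ) < (q : ℚ) - 1 := by
    have : (2 : ℚ) ≤ q := by exact_mod_cast hq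
    linarith
  have hq2 : (0 : ℚ) < (q : ℚ) + 1 := by positivity
  have hI1 : (I.card : ℚ) * 1 ≤ ∑ B ∈ I, ((q : ℚ) + 2 - (1 : ℕ)) * wInf M B := by
    rw [← nsmul_eq_mul]
    apply Finset.card_nsmul_le_sum
    intro B hB
    rw [hI, Iq, Finset.mem_filter, mem_Rq] at hB
    have hw := wInf_ge_of_eRk_eq (hB.1.1.trans hG) hB.1.2
    calc (1 : ℚ) = ((q : ℚ) + 1) * (1 / ((q : ℚ) + 1)) := by field_simp
      _ ≤ ((q : ℚ) + 1) * wInf M B := by gcongr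
      _ = ((q : ℚ) + 2 - (1 : ℕ)) * wInf M B := by push_cast; ring
  have hR1 : (Rb.card : ℚ) * (((q : ℚ) + 1) / ((q : ℚ) - 1)) ≤
      ∑ B ∈ Rb, ((q : ℚ) + 2 - (1 : ℕ)) * wInf M B := by
    rw [← nsmul_eq_mul]
    apply Finset.card_nsmul_le_sum
    intro B hB
    rw [hRb, Finset.mem_filter, mem_Rq] at hB
    have hcard : q + 1 ≤ B.card := by
      have h4 := M.eRk_le_encard (B : Set α)
      rw [hB.1.2, Set.encard_coe_eq_coe_finsetCard] at h4
      have h4' : q ≤ B.card := by exact_mod_cast h4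
      omega
    have hw := wInf_ge_of_succ_le_card hs (by omega) (hB.1.1.trans hG) hB.1.2 hcard
    calc ((q : ℚ) + 1) / ((q : ℚ) - 1) = ((q : ℚ) + 1) * (1 / ((q : ℚ) - 1)) := by ring
      _ ≤ ((q : ℚ) + 1) * wInf M B := by gcongr
      _ = ((q : ℚ) + 2 - (1 : ℕ)) * wInf M B := by push_cast; ring
  have hsplit : ∑ B ∈ Rq M G q, ((q : ℚ) + 2 - (1 : ℕ)) * wInf M B =
      ∑ B ∈ I, ((q : ℚ) + 2 - (1 : ℕ)) * wInf M B + ∑ B ∈ Rb, ((q : ℚ) + 2 - (1 : ℕ)) * wInf M B := by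
    rw [hI, hRb, Iq]
    exact (Finset.sum_filter_add_sum_filter_not _ _ _).symm
  -- the demand
  have hDF : (1 : ℚ) ≤ (DFq M G q 1 : ℚ) := by exact_mod_cast one_le_DFq_one hr
  -- the key inequality `I(q − 1) ≤ Rb(q + 3)`
  have hgq : q ≤ G.card := by
    have h4 := M.eRk_le_encard (G : Set α)
    rw [hr, Set.encard_coe_eq_coe_finsetCard] at h4
    exact_mod_cast h4
  have hdc' : (I.card : ℚ) * ((G.card : ℚ) - q) ≤ ((q : ℚ) + 1) * (Rb.card : ℚ) := by
    have h := (Nat.cast_le (α := ℚ)).2 (hdc.trans (Nat.mul_le_mul_left (q + 1) hNq1))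
    push_cast [Nat.cast_sub hgq] at h
    linarith
  have hg' : (q : ℚ) * q ≤ ((G.card : ℚ) - q) * ((q : ℚ) + 3) + 1 := by
    have h := (Nat.cast_le (α := ℚ)).2 hg
    push_cast [Nat.cast_sub hgq] at h
    linarith
  have hA : (I.card : ℚ) * ((q : ℚ) - 1) ≤ (Rb.card : ℚ) * ((q : ℚ) + 3) := by
    have hx0 : (0 : ℚ) ≤ I.card := by positivity
    have hq3 : (0 : ℚ) ≤ (q : ℚ) + 3 := by positivity
    have h1 : (I.card : ℚ) * ((q : ℚ) * q - 1) ≤ (I.card : ℚ) * (((G.card : ℚ) - q) * ((q : ℚ) + 3)) :=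
      mul_le_mul_of_nonneg_left (by linarith) hx0
    have h2 : (I.card : ℚ) * (((G.card : ℚ) - q) * ((q : ℚ) + 3)) ≤
        ((q : ℚ) + 1) * (Rb.card : ℚ) * ((q : ℚ) + 3) := by
      rw [← mul_assoc]
      exact mul_le_mul_of_nonneg_right hdc' hq3
    have h3 : ((q : ℚ) + 1) * ((I.card : ℚ) * ((q : ℚ) - 1)) ≤ ((q : ℚ) + 1) * ((Rb.card : ℚ) * ((q : ℚ) + 3)) := by
      nlinarith
    exact le_of_mul_le_mul_left h3 hq2
  -- assemble
  have key : (0 : ℚ) ≤ (I.card : ℚ) * 1 + (Rb.card : ℚ) * (((q : ℚ) + 1) / ((q : ℚ) - 1)) -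
      (((q : ℚ) + 2) / ((q : ℚ) + 1)) * ((I.card : ℚ) + (Rb.card : ℚ) - 1) := by
    have e : (I.card : ℚ) * 1 + (Rb.card : ℚ) * (((q : ℚ) + 1) / ((q : ℚ) - 1)) -
        (((q : ℚ) + 2) / ((q : ℚ) + 1)) * ((I.card : ℚ) + (Rb.card : ℚ) - 1) =
        ((Rb.card : ℚ) * ((q : ℚ) + 3) + ((q : ℚ) + 2) * ((q : ℚ) - 1) - (I.card : ℚ) * ((q : ℚ) - 1)) /
          (((q : ℚ) + 1) * ((q : ℚ) - 1)) := by
      field_simp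
      ring
    rw [e]
    apply div_nonneg
    · have : (0 : ℚ) ≤ ((q : ℚ) + 2) * ((q : ℚ) - 1) := by positivity
      linarith
    · positivity
  have hΦ : (0 : ℚ) ≤ ((q : ℚ) + 2) / ((q : ℚ) + 1) := by positivity
  have hmono : (((q : ℚ) + 2) / ((q : ℚ) + 1)) * ((I.card : ℚ) + (Rb.card : ℚ) - (DFq M G q 1 : ℚ)) ≤
      (((q : ℚ) + 2) / ((q : ℚ) + 1)) * ((I.card : ℚ) + (Rb.card : ℚ) - 1) := by
    apply mul_le_mul_of_nonneg_left _ hΦ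
    linarith
  unfold Jq
  rw [hsplit, hN]
  set a : ℚ := ((q : ℚ) + 1) / ((q : ℚ) - 1) with ha
  set Φ : ℚ := ((q : ℚ) + 2) / ((q : ℚ) + 1) with hΦdef
  set SI := ∑ B ∈ I, ((q : ℚ) + 2 - (1 : ℕ)) * wInf M B with hSI
  set SR := ∑ B ∈ Rb, ((q : ℚ) + 2 - (1 : ℕ)) * wInf M B with hSR
  linarith [hI1, hR1, key, hmono]

end PercRepro.GenQ
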